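/-
Copyright (c) 2026 The HodgeCM formalization project (cell hodgecm-mathlib, squad K2·E4). Prover seat hodgecm-mathlib-K2E4-p10 (g4).
Released under Apache 2.0 license as described in the file LICENSE.
-/
import Summits.HodgeConjecture.HodgeConjecture.Theorems.K2E1PowerMomentHolomorphy              -- ★ FILE A (this seat): moments are holomorphic, real points, identity theorem
import Summits.HodgeConjecture.HodgeConjecture.Theorems.K2E1IntertwiningScalarEulerProductU2   -- ★ FILE 3 p858297 (K2E2-p12 g4): tokens `P_v`, `A`, `one_le_localHeight`; brings ★ FILE 2, ★ (b2)(b3), ★ (3b)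
import Summits.HodgeConjecture.HodgeConjecture.Theorems.K2E1IntertwinedCoeffContinuousCMTwo     -- ★ p858110 (this seat): `integrable_borelHeight_weylLongU_mul_rpow_cm_two`
import Summits.HodgeConjecture.HodgeConjecture.Theorems.K2E1UnipotentHaarNormalisationU2       -- ★ (D1-a): `isInvInvariant_of_isHaarMeasure_two`
import Mathlib.MeasureTheory.Integral.Pi
import Mathlib.Analysis.SpecialFunctions.JapaneseBracket
import Mathlib.MeasureTheory.Measure.Haar.Unique
import HarnessLib

/-!
# K2·E1 — `K2E1IntertwiningLocalFactorIntegrableU2` (FILE B of «W5-B»): THE FACTORS OF THE `U(J₂)` INTERTWINING SCALAR CONVERGE ON `Re z > ½` AND ARE HOLOMORPHIC THERE;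
# the scalar itself is holomorphic on `Re z > 1`

Track B ∕ K2-LIT, crux h413 = `stmt-HodgeConjecture-24833`, route of record `HCCMUnconditional`; cell `hodgecm-mathlib`, squad K2, ENGINE E1 (campaign «EIS-WHITTAKER-2», rung
«W5-B», deal of K2E1-plan (g4) 2026-09-04T07:29:46Z, taken 07:35:08Z).  Prover seat `hodgecm-mathlib-K2E4-p10` (g4).  THEOREMS ONLY (no `def`, no `instance`, no notation,
no named-fact hypothesis, no `sorry`); lane `--supports stmt-HodgeConjecture-24833 --as helper` (count-neutral).  Closes no socket.
CM pair `L ∕ L⁺`, `c = complexConj`, `N = 2`, `δ ∈ L⁻ ∖ 0`.  Tokens of ★ FILE 3 `K2E1IntertwiningScalarEulerProductU2`: the archimedean factor `A(s) = ∏_{w∣∞}(1 + (wδ)²s_{w|L⁺}²)` on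
`L⁺ ⊗ ℝ`, the local factor `P_v(x) = ∏_{w∣v} max(1, ‖ι_w x‖_w·‖δ‖_w)` on `L⁺_v`, and the integrand `H(w₀v)^z` of the intertwining scalar on `N(𝔸)`.

THE MATHEMATICS [MoeglinWaldspurger1995, II.1.6–II.1.7, IV.1.11; Langlands1976, Appendix; GindikinKarpelevich1962; Titchmarsh1939, §2.8].  The complex moments
`c_∞(z) = μ_E(D_∞)⁻¹·∫ A^{−z} dμ_E`, `a_v(z) = νv(𝒪_v)⁻¹·∫ P_v^{−z} dνv` and `c(z) = ν(𝓕)⁻¹·∫_{N(𝔸)} H(w₀v)^z dν` are holomorphic on the half-plane where the REAL moments converge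
(★ FILE A).  Convergence: `A^{−x} ∈ L¹(L⁺ ⊗ ℝ)` for `x > ½` — `A(s) = ∏_{i real place of L⁺}(1 + c_i s_i²)` (`InfinitePlace L ≃ InfinitePlace L⁺`, all real; Mathlib
`IsCMField.equivInfinitePlace`), each `∫_ℝ (1 + c t²)^{−x} dt < ∞` iff `2x > 1` (Mathlib `integrable_rpow_neg_one_add_norm_sq`), product measure (`Integrable.fintype_prod`), Haar
uniqueness; `P_v^{−x} ∈ L¹(L⁺_v)` for `x > ½` — `P_v(x) ≥ (∏_{w∣v} min(1, ‖δ‖_w))·max(1, ‖x‖_v)²` (★ (b2) `prod_extension_max_one_normAbs_of_finrank_eq_two`) and ★ FILE 2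
`integrable_max_one_normAbs_rpow_neg` at `s = 2x > 1`; `H(w₀v)^σ ∈ L¹(N(𝔸))` for `σ > 1` ★ p858110 (every Haar measure of the abelian `N(𝔸)` is inversion invariant ★).
* §1 `integrable_one_add_mul_sq_rpow_neg`, `integrable_archFactor_rpow_neg_of_half_lt` — the archimedean factor converges for `x > ½`.
* §2 `min_one_mul_max_one_le`, `algebraMap_finiteAdeleRing_apply_ne_zero`, `localFactor_lower_bound`, `integrable_localFactor_rpow_neg_of_half_lt` — the local factors converge for `x > ½`.
* §3 `differentiableOn_archMean`, `differentiableOn_localMean` (on `{½ < Re}`), `differentiableOn_intertwiningScalar` (on `{1 < Re}`); the real points `archMean_ofReal`, `localMean_ofReal`,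
  `intertwiningScalar_ofReal` (= ★ FILE 3's three terms at `z = σ`); `archMean_one_ne_zero`, `localMean_one_ne_zero` (the residue factors at `z = 1`).
HONEST LABEL: HC_CM is proved only modulo the 7 printed citations (2 remaining named inputs: hLiu418 = `stmt-HodgeConjecture-24832`, h413 = `stmt-HodgeConjecture-24833`) until rung 0
closes; this file asserts no named fact and closes no socket; count-neutral.

## References
* [MoeglinWaldspurger1995] C. Mœglin, J.-L. Waldspurger, *Spectral Decomposition and Eisenstein Series* (1995), II.1.6–II.1.7, IV.1.11.
* [Langlands1976] R. P. Langlands, *On the Functional Equations Satisfied by Eisenstein Series*, LNM 544 (1976), Appendix.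
* [GindikinKarpelevich1962] S. G. Gindikin, F. I. Karpelevič, Dokl. Akad. Nauk SSSR 145 (1962), 252–255.
* [Titchmarsh1939] E. C. Titchmarsh, *The Theory of Functions*, 2nd ed. (1939), §2.8.
-/

set_option autoImplicit false
set_option linter.dupNamespace false -- the mandated namespace repeats `HodgeConjecture.HodgeConjecture`

noncomputable section

open MeasureTheory Measure NumberField NumberField.InfinitePlace NumberField.mixedEmbedding IsDedekindDomain IsDedekindDomain.HeightOneSpectrum Set Filter Function Topology
open scoped ENNReal NNReal Classical
open Literature.NumberTheory.GaloisRepresentations.IsNonarchimedeanLocalField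
open Literature.NumberTheory.Automorphic Literature.NumberTheory.Automorphic.UnitaryGroup AdelicGroupData Literature.NumberTheory.LFunctions
open Summit.HodgeConjecture.HodgeConjecture.Cruxes.H413
open Summit.HodgeConjecture.HodgeConjecture.Cruxes.H413.K2E1PowerMomentHolomorphy
open Summit.HodgeConjecture.HodgeConjecture.Cruxes.H413.K2E1IntertwiningLocalFactorU2Height (prod_extension_max_one_normAbs_of_finrank_eq_two)
open Summit.HodgeConjecture.HodgeConjecture.Cruxes.H413.K2E1IntertwiningLocalFactorU2Line (continuous_prod_extension_max_one)
open Summit.HodgeConjecture.HodgeConjecture.Cruxes.H413.K2E1IntertwiningLocalFactorU2 (integrable_max_one_normAbs_rpow_neg)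
open Summit.HodgeConjecture.HodgeConjecture.Cruxes.H413.K2E1IntertwiningScalarEulerProductU2 (one_le_localHeight)
open Summit.HodgeConjecture.HodgeConjecture.Cruxes.H413.K2E1IntertwiningScalarLineIntegralU2 (archFactor_pos)
open Summit.HodgeConjecture.HodgeConjecture.Cruxes.H413.K2E1IntertwinedCoeffContinuousCMTwo (integrable_borelHeight_weylLongU_mul_rpow_cm_two)
open Summit.HodgeConjecture.HodgeConjecture.Cruxes.H413.K2E1UnipotentHaarNormalisationU2 (isInvInvariant_of_isHaarMeasure_two)

namespace Summit.HodgeConjecture.HodgeConjecture.Cruxes.H413.K2E1IntertwiningLocalFactorIntegrableU2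

variable (L : Type) [Field L] [NumberField L] [IsCMField L] {δ : L} (hδ : δ ≠ 0)

/-! ## §1 The archimedean factor converges on `x > ½` -/

omit [NumberField L] [IsCMField L] in
/-- **`∫_ℝ (1 + c t²)^{−x} dt < ∞` for `c > 0`, `x > ½`** — Mathlib `integrable_rpow_neg_one_add_norm_sq` (`(1 + t²)^{−x}`, `2x > 1 = dim ℝ`) and `(1 + c t²)^{−x} ≤ min(1, c)^{−x}·(1 + t²)^{−x}`.
[cite: Titchmarsh1939, §2.8] -/
theorem integrable_one_add_mul_sq_rpow_neg {c x : ℝ} (hc : 0 < c) (hx : 1 / 2 < x) : Integrable (fun t : ℝ => (1 + c * t ^ 2) ^ (-x)) := by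
  have h0 : Integrable (fun t : ℝ => ((1 : ℝ) + ‖t‖ ^ 2) ^ (-(2 * x) / 2)) := integrable_rpow_neg_one_add_norm_sq (by rw [Module.finrank_self]; push_cast; linarith)
  have h1 : Integrable (fun t : ℝ => (min 1 c) ^ (-x) * ((1 : ℝ) + t ^ 2) ^ (-x)) := by
    refine (h0.const_mul ((min 1 c) ^ (-x))).congr (Eventually.of_forall fun t => ?_)
    simp only [Real.norm_eq_abs, sq_abs]
    rw [show (-(2 * x) / 2 : ℝ) = -x by ring]
  have hm : 0 < min 1 c := lt_min one_pos hc
  refine h1.mono' ((continuous_const.add (continuous_const.mul (continuous_pow 2))).rpow_const fun t => Or.inl (ne_of_gt (add_pos_of_pos_of_nonneg one_pos (mul_nonneg hc.le (sq_nonneg t))))).aestronglyMeasurable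
    (Eventually.of_forall fun t => ?_)
  rw [Real.norm_of_nonneg (Real.rpow_nonneg (by positivity) _)]
  have hle : min 1 c * (1 + t ^ 2) ≤ 1 + c * t ^ 2 := by
    nlinarith [min_le_left 1 c, min_le_right 1 c, sq_nonneg t]
  calc (1 + c * t ^ 2) ^ (-x) ≤ (min 1 c * (1 + t ^ 2)) ^ (-x) := Real.rpow_le_rpow_of_nonpos (by positivity) hle (by linarith)
    _ = (min 1 c) ^ (-x) * (1 + t ^ 2) ^ (-x) := Real.mul_rpow hm.le (by positivity)

omit [IsCMField L] in
include hδ in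
/-- The `δ`-entry of the principal finite adele is non-zero at every place (`δ·δ⁻¹ = 1` componentwise). [folklore] -/
theorem algebraMap_finiteAdeleRing_apply_ne_zero (w : HeightOneSpectrum (𝓞 L)) : (algebraMap L (FiniteAdeleRing (𝓞 L) L) δ) w ≠ 0 := by
  intro h
  have hmul : (algebraMap L (FiniteAdeleRing (𝓞 L) L) δ) w * (algebraMap L (FiniteAdeleRing (𝓞 L) L) δ⁻¹) w = 1 := by
    change (algebraMap L (FiniteAdeleRing (𝓞 L) L) δ * algebraMap L (FiniteAdeleRing (𝓞 L) L) δ⁻¹) w = 1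
    rw [← map_mul, mul_inv_cancel₀ hδ, map_one]
    rfl
  rw [h, zero_mul] at hmul
  exact zero_ne_one hmul

include hδ in
/-- **`A^{−x} ∈ L¹(μ_E)` for EVERY additive Haar measure `μ_E` on `L⁺ ⊗ ℝ` and every `x > ½`** — `A(s) = ∏_{i}(1 + c_i·s_i²)` over the (all real) places `i` of `L⁺`
(`InfinitePlace L ≃ InfinitePlace L⁺`, Mathlib `IsCMField.equivInfinitePlace`; `c_i = (w_iδ)² > 0`), so `A^{−x}` is a product of one-variable integrable functions on the product space
`mixedSpace L⁺ = (real places → ℝ) × (∅ → ℂ)` (`Integrable.fintype_prod`, volume), and `μ_E = const·volume`. [cite: MoeglinWaldspurger1995, II.1.6] [cite: Titchmarsh1939, §2.8] -/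
theorem integrable_archFactor_rpow_neg_of_half_lt (μE : Measure (mixedSpace ↥(maximalRealSubfield L))) [μE.IsAddHaarMeasure] {x : ℝ} (hx : 1 / 2 < x) :
    Integrable (fun s : mixedSpace ↥(maximalRealSubfield L) => (∏ w : InfinitePlace L, ((1 : ℝ) + (w δ) ^ 2 * (s.1 ⟨w.comap (algebraMap ↥(maximalRealSubfield L) L), K2E1HeightBigCellLineFormulaU2.isReal_comap_maximalRealSubfield L w⟩) ^ 2)) ^ (-x)) μE := by
  -- the index bijection `InfinitePlace L ≃ {v : InfinitePlace L⁺ // v.IsReal}` and the constants `c_i`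
  set E : InfinitePlace L ≃ {v : InfinitePlace ↥(maximalRealSubfield L) // v.IsReal} :=
    (IsCMField.equivInfinitePlace L).trans (Equiv.subtypeUnivEquiv (fun v : InfinitePlace ↥(maximalRealSubfield L) => IsTotallyReal.isReal v)).symm with hE
  set c : {v : InfinitePlace ↥(maximalRealSubfield L) // v.IsReal} → ℝ := fun i => ((E.symm i) δ) ^ 2 with hc
  have hcpos : ∀ i, 0 < c i := fun i => pow_pos (InfinitePlace.pos_iff.2 hδ) 2
  -- the product function on the real coordinates is integrable
  have hg : Integrable (fun a : {v : InfinitePlace ↥(maximalRealSubfield L) // v.IsReal} → ℝ => ∏ i, (1 + c i * a i ^ 2) ^ (-x)) (Measure.pi fun _ => (volume : Measure ℝ)) :=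
    Integrable.fintype_prod (f := fun i (t : ℝ) => (1 + c i * t ^ 2) ^ (-x)) fun i => integrable_one_add_mul_sq_rpow_neg (hcpos i) hx
  -- the complex coordinates form a one-point space of volume `1`
  haveI : IsEmpty {w : InfinitePlace ↥(maximalRealSubfield L) // w.IsComplex} :=
    ⟨fun w => (not_isComplex_iff_isReal.2 (IsTotallyReal.isReal w.1)) w.2⟩
  haveI : IsFiniteMeasure (volume : Measure ({w : InfinitePlace ↥(maximalRealSubfield L) // w.IsComplex} → ℂ)) :=
    ⟨by rw [volume_pi, Measure.pi_univ]; simp⟩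
  have hG : Integrable (fun s : mixedSpace ↥(maximalRealSubfield L) => (∏ i, (1 + c i * s.1 i ^ 2) ^ (-x)) * (fun _ : ({w : InfinitePlace ↥(maximalRealSubfield L) // w.IsComplex} → ℂ) => (1 : ℝ)) s.2)
      (volume : Measure (mixedSpace ↥(maximalRealSubfield L))) := hg.mul_prod (integrable_const (1 : ℝ))
  -- `A(s)^{−x}` IS that product function
  have hAF : ∀ s : mixedSpace ↥(maximalRealSubfield L), (∏ w : InfinitePlace L, ((1 : ℝ) + (w δ) ^ 2 * (s.1 ⟨w.comap (algebraMap ↥(maximalRealSubfield L) L), K2E1HeightBigCellLineFormulaU2.isReal_comap_maximalRealSubfield L w⟩) ^ 2)) ^ (-x) = (∏ i, (1 + c i * s.1 i ^ 2) ^ (-x)) * (fun _ : ({w : InfinitePlace ↥(maximalRealSubfield L) // w.IsComplex} → ℂ) => (1 : ℝ)) s.2 := by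
    intro s
    rw [mul_one, Real.finsetProd_rpow _ _ (fun i _ => by positivity)]
    congr 1
    exact Fintype.prod_equiv E _ _ fun w => by rw [hc]; simp only [Equiv.symm_apply_apply]; rfl
  have hvol : Integrable (fun s : mixedSpace ↥(maximalRealSubfield L) => (∏ w : InfinitePlace L, ((1 : ℝ) + (w δ) ^ 2 * (s.1 ⟨w.comap (algebraMap ↥(maximalRealSubfield L) L), K2E1HeightBigCellLineFormulaU2.isReal_comap_maximalRealSubfield L w⟩) ^ 2)) ^ (-x)) (volume : Measure (mixedSpace ↥(maximalRealSubfield L))) :=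
    hG.congr (Eventually.of_forall fun s => (hAF s).symm)
  -- Haar uniqueness
  have hμ : μE = μE.addHaarScalarFactor volume • volume := isAddLeftInvariant_eq_smul _ _
  rw [hμ, ENNReal.smul_def]
  exact hvol.smul_measure ENNReal.coe_ne_top

/-! ## §2 The local factors converge on `x > ½` -/

omit [NumberField L] [IsCMField L] in
/-- `min(1, d)·max(1, a) ≤ max(1, a·d)` in `ℝ≥0`. [folklore] -/
theorem min_one_mul_max_one_le (a d : ℝ≥0) : min 1 d * max 1 a ≤ max 1 (a * d) := by
  rcases le_total d 1 with hd | hd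
  · rw [min_eq_right hd]
    rcases le_total a 1 with ha | ha
    · rw [max_eq_left ha, mul_one]; exact hd.trans (le_max_left _ _)
    · rw [max_eq_right ha, mul_comm]; exact le_max_right _ _
  · rw [min_eq_left hd, one_mul]
    exact max_le (le_max_left _ _) ((le_mul_of_one_le_right (by positivity) hd).trans (le_max_right _ _))

/-- **`P_v(x) ≥ (∏_{w∣v} min(1, ‖δ‖_w))·max(1, ‖x‖_v)²`** (termwise `min(1,d)·max(1,a) ≤ max(1, a·d)` and ★ (b2) `∏_{w∣v} max(1, ‖ι_w x‖_w) = max(1, ‖x‖_v)²`).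
[cite: MoeglinWaldspurger1995, II.1.6] -/
theorem localFactor_lower_bound (v : HeightOneSpectrum (𝓞 ↥(maximalRealSubfield L))) (x : v.adicCompletion ↥(maximalRealSubfield L)) :
    (letI := Extension.fintype (𝓞 ↥(maximalRealSubfield L)) ↥(maximalRealSubfield L) L (𝓞 L) v; ∏ w : v.Extension (𝓞 L), min 1 (normAbs (w.1.adicCompletion L) ((algebraMap L (FiniteAdeleRing (𝓞 L) L) δ) w.1))) *
        (max 1 (normAbs (v.adicCompletion ↥(maximalRealSubfield L)) x)) ^ 2 ≤ (letI := Extension.fintype (𝓞 ↥(maximalRealSubfield L)) ↥(maximalRealSubfield L) L (𝓞 L) v; ∏ w : v.Extension (𝓞 L), max 1 (normAbs (w.1.adicCompletion L) (Extension.adicCompletionSemialgHom ↥(maximalRealSubfield L) L w x) * normAbs (w.1.adicCompletion L) ((algebraMap L (FiniteAdeleRing (𝓞 L) L) δ) w.1))) := by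
  letI := Extension.fintype (𝓞 ↥(maximalRealSubfield L)) ↥(maximalRealSubfield L) L (𝓞 L) v
  haveI : Algebra.IsQuadraticExtension ↥(maximalRealSubfield L) L := IsCMField.isQuadraticExtension L
  rw [← prod_extension_max_one_normAbs_of_finrank_eq_two ↥(maximalRealSubfield L) L v (Algebra.IsQuadraticExtension.finrank_eq_two ↥(maximalRealSubfield L) L) x,
    ← Finset.prod_mul_distrib]
  exact Finset.prod_le_prod' fun w _ => min_one_mul_max_one_le _ _

include hδ in
/-- **`P_v^{−x} ∈ L¹(L⁺_v)` for every additive Haar measure and every `x > ½`** (`P_v^{−x} ≤ C_v^{−x}·max(1, ‖·‖_v)^{−2x}`, ★ FILE 2 `integrable_max_one_normAbs_rpow_neg` at `s = 2x > 1`).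
[cite: Langlands1976, Appendix] [cite: MoeglinWaldspurger1995, II.1.6] -/
theorem integrable_localFactor_rpow_neg_of_half_lt (v : HeightOneSpectrum (𝓞 ↥(maximalRealSubfield L)))
    [MeasurableSpace (v.adicCompletion ↥(maximalRealSubfield L))] [BorelSpace (v.adicCompletion ↥(maximalRealSubfield L))]
    (μ : Measure (v.adicCompletion ↥(maximalRealSubfield L))) [μ.IsAddHaarMeasure] {x : ℝ} (hx : 1 / 2 < x) :
    Integrable (fun t : v.adicCompletion ↥(maximalRealSubfield L) => (((letI := Extension.fintype (𝓞 ↥(maximalRealSubfield L)) ↥(maximalRealSubfield L) L (𝓞 L) v; ∏ w : v.Extension (𝓞 L), max 1 (normAbs (w.1.adicCompletion L) (Extension.adicCompletionSemialgHom ↥(maximalRealSubfield L) L w t) * normAbs (w.1.adicCompletion L) ((algebraMap L (FiniteAdeleRing (𝓞 L) L) δ) w.1))) : ℝ≥0) : ℝ) ^ (-x)) μ := by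
  letI := Extension.fintype (𝓞 ↥(maximalRealSubfield L)) ↥(maximalRealSubfield L) L (𝓞 L) v
  set C : ℝ≥0 := ∏ w : v.Extension (𝓞 L), min 1 (normAbs (w.1.adicCompletion L) ((algebraMap L (FiniteAdeleRing (𝓞 L) L) δ) w.1)) with hC
  have hC0 : 0 < C := Finset.prod_pos fun w _ => lt_min one_pos (pos_iff_ne_zero.2 ((map_ne_zero _).2 (algebraMap_finiteAdeleRing_apply_ne_zero L hδ w.1)))
  have hmaj := (integrable_max_one_normAbs_rpow_neg μ (s := 2 * x) (by linarith)).const_mul (((C : ℝ≥0) : ℝ) ^ (-x))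
  refine hmaj.mono' ?_ (Eventually.of_forall fun t => ?_)
  · exact ((NNReal.continuous_coe.comp (continuous_prod_extension_max_one (E := L) (δ := δ) v)).rpow_const fun t =>
      Or.inl (ne_of_gt (lt_of_lt_of_le zero_lt_one (by exact_mod_cast one_le_localHeight L v t)))).aestronglyMeasurable
  · rw [Real.norm_of_nonneg (Real.rpow_nonneg (NNReal.coe_nonneg _) _)]
    have hm0 : 0 < max 1 ((normAbs (v.adicCompletion ↥(maximalRealSubfield L)) t : ℝ≥0) : ℝ) := by positivity
    have hle : ((C : ℝ≥0) : ℝ) * (max 1 ((normAbs (v.adicCompletion ↥(maximalRealSubfield L)) t : ℝ≥0) : ℝ)) ^ 2 ≤ (((letI := Extension.fintype (𝓞 ↥(maximalRealSubfield L)) ↥(maximalRealSubfield L) L (𝓞 L) v; ∏ w : v.Extension (𝓞 L), max 1 (normAbs (w.1.adicCompletion L) (Extension.adicCompletionSemialgHom ↥(maximalRealSubfield L) L w t) * normAbs (w.1.adicCompletion L) ((algebraMap L (FiniteAdeleRing (𝓞 L) L) δ) w.1))) : ℝ≥0) : ℝ) := by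
      have h := localFactor_lower_bound L (δ := δ) v t
      rw [← hC] at h
      exact_mod_cast h
    calc (((letI := Extension.fintype (𝓞 ↥(maximalRealSubfield L)) ↥(maximalRealSubfield L) L (𝓞 L) v; ∏ w : v.Extension (𝓞 L), max 1 (normAbs (w.1.adicCompletion L) (Extension.adicCompletionSemialgHom ↥(maximalRealSubfield L) L w t) * normAbs (w.1.adicCompletion L) ((algebraMap L (FiniteAdeleRing (𝓞 L) L) δ) w.1))) : ℝ≥0) : ℝ) ^ (-x)
        ≤ (((C : ℝ≥0) : ℝ) * (max 1 ((normAbs (v.adicCompletion ↥(maximalRealSubfield L)) t : ℝ≥0) : ℝ)) ^ 2) ^ (-x) :=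
          Real.rpow_le_rpow_of_nonpos (by positivity) hle (by linarith)
      _ = ((C : ℝ≥0) : ℝ) ^ (-x) * (max 1 ((normAbs (v.adicCompletion ↥(maximalRealSubfield L)) t : ℝ≥0) : ℝ)) ^ (-(2 * x)) := by
          rw [Real.mul_rpow (NNReal.coe_nonneg _) (by positivity), show (-(2 * x) : ℝ) = 2 * (-x) by ring, Real.rpow_mul hm0.le, Real.rpow_two]

/-! ## §3 Holomorphy of the three means; their real points; the residue factors at `z = 1` -/

include hδ in
/-- **`c_∞(z) = μ_E(D_∞)⁻¹·∫_{L⁺⊗ℝ} A(s)^{−z} dμ_E` is holomorphic on `{Re z > ½}`** (★ FILE A + §1). [cite: MoeglinWaldspurger1995, IV.1.11] [cite: Titchmarsh1939, §2.8] -/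
theorem differentiableOn_archMean (μE : Measure (mixedSpace ↥(maximalRealSubfield L))) [μE.IsAddHaarMeasure] :
    DifferentiableOn ℂ (fun z : ℂ => ((((μE (ZSpan.fundamentalDomain (latticeBasis ↥(maximalRealSubfield L)))).toReal⁻¹ : ℝ)) : ℂ) *
      ∫ s : mixedSpace ↥(maximalRealSubfield L), (((∏ w : InfinitePlace L, ((1 : ℝ) + (w δ) ^ 2 * (s.1 ⟨w.comap (algebraMap ↥(maximalRealSubfield L) L), K2E1HeightBigCellLineFormulaU2.isReal_comap_maximalRealSubfield L w⟩) ^ 2)) : ℝ) : ℂ) ^ (-z) ∂μE) {z : ℂ | 1 / 2 < z.re} := by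
  have hcont : Continuous fun s : mixedSpace ↥(maximalRealSubfield L) => (∏ w : InfinitePlace L, ((1 : ℝ) + (w δ) ^ 2 * (s.1 ⟨w.comap (algebraMap ↥(maximalRealSubfield L) L), K2E1HeightBigCellLineFormulaU2.isReal_comap_maximalRealSubfield L w⟩) ^ 2)) := by
    refine continuous_finsetProd _ fun w _ => ?_
    exact continuous_const.add (continuous_const.mul (((continuous_apply _).comp continuous_fst).pow 2))
  have hmeas := hcont.measurable
  exact (differentiableOn_integral_ofReal_cpow_neg hmeas (archFactor_pos L) fun σ hσ => integrable_archFactor_rpow_neg_of_half_lt L hδ μE hσ).const_mul _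

include hδ in
/-- **`a_v(z) = νv(𝒪_v)⁻¹·∫_{L⁺_v} P_v(x)^{−z} dνv` is holomorphic on `{Re z > ½}`** (★ FILE A + §2). [cite: Langlands1976, Appendix] [cite: MoeglinWaldspurger1995, IV.1.11] -/
theorem differentiableOn_localMean (v : HeightOneSpectrum (𝓞 ↥(maximalRealSubfield L)))
    [MeasurableSpace (v.adicCompletion ↥(maximalRealSubfield L))] [BorelSpace (v.adicCompletion ↥(maximalRealSubfield L))]
    (μ : Measure (v.adicCompletion ↥(maximalRealSubfield L))) [μ.IsAddHaarMeasure] :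
    DifferentiableOn ℂ (fun z : ℂ => ((((μ (v.adicCompletionIntegers ↥(maximalRealSubfield L))).toReal⁻¹ : ℝ)) : ℂ) *
      ∫ t : v.adicCompletion ↥(maximalRealSubfield L), ((((letI := Extension.fintype (𝓞 ↥(maximalRealSubfield L)) ↥(maximalRealSubfield L) L (𝓞 L) v; ∏ w : v.Extension (𝓞 L), max 1 (normAbs (w.1.adicCompletion L) (Extension.adicCompletionSemialgHom ↥(maximalRealSubfield L) L w t) * normAbs (w.1.adicCompletion L) ((algebraMap L (FiniteAdeleRing (𝓞 L) L) δ) w.1))) : ℝ≥0) : ℝ) : ℂ) ^ (-z) ∂μ) {z : ℂ | 1 / 2 < z.re} := by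
  letI := Extension.fintype (𝓞 ↥(maximalRealSubfield L)) ↥(maximalRealSubfield L) L (𝓞 L) v
  have hmeas : Measurable fun t : v.adicCompletion ↥(maximalRealSubfield L) => (((letI := Extension.fintype (𝓞 ↥(maximalRealSubfield L)) ↥(maximalRealSubfield L) L (𝓞 L) v; ∏ w : v.Extension (𝓞 L), max 1 (normAbs (w.1.adicCompletion L) (Extension.adicCompletionSemialgHom ↥(maximalRealSubfield L) L w t) * normAbs (w.1.adicCompletion L) ((algebraMap L (FiniteAdeleRing (𝓞 L) L) δ) w.1))) : ℝ≥0) : ℝ) :=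
    (NNReal.continuous_coe.comp (continuous_prod_extension_max_one (E := L) (δ := δ) v)).measurable
  exact (differentiableOn_integral_ofReal_cpow_neg hmeas (fun t => lt_of_lt_of_le zero_lt_one (by exact_mod_cast one_le_localHeight L v t))
    fun σ hσ => integrable_localFactor_rpow_neg_of_half_lt L hδ v μ hσ).const_mul _

/-- **`c(z) = ν(𝓕)⁻¹·∫_{N(𝔸)} H(w₀v)^z dν` is holomorphic on `{Re z > 1}`** (★ FILE A; convergence ★ p858110 `integrable_borelHeight_weylLongU_mul_rpow_cm_two` at `g = 1`, every Haar measure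
of `N(𝔸)` being inversion invariant ★). [cite: MoeglinWaldspurger1995, II.1.6–II.1.7] [cite: Titchmarsh1939, §2.8] -/
theorem differentiableOn_intertwiningScalar [MeasurableSpace (quasiSplit (↥(maximalRealSubfield L)) L (IsCMField.complexConj L) 2).Adelic] [BorelSpace (quasiSplit (↥(maximalRealSubfield L)) L (IsCMField.complexConj L) 2).Adelic]
    (ν : Measure ↥(adelicUnipotent (↥(maximalRealSubfield L)) L (IsCMField.complexConj L) 2)) [ν.IsHaarMeasure]
    {𝓕 : Set ↥(adelicUnipotent (↥(maximalRealSubfield L)) L (IsCMField.complexConj L) 2)}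
    (h𝓕N : IsFundamentalDomain ↥(rationalUnipotent (↥(maximalRealSubfield L)) L (IsCMField.complexConj L) 2) 𝓕 ν) (h𝓕c : IsCompact (closure 𝓕)) :
    DifferentiableOn ℂ (fun z : ℂ => ((((ν 𝓕).toReal⁻¹ : ℝ)) : ℂ) * ∫ v, (((borelHeight (((quasiSplit (↥(maximalRealSubfield L)) L (IsCMField.complexConj L) 2).toAdelic (weylLongU ((IsCMField.complexConj L : L ≃ₐ[↥(maximalRealSubfield L)] L) : L →+* L) (rfl : ((StdForm.antidiagonal 2).over L) = ((StdForm.antidiagonal 2).over L)))) * (v : (quasiSplit (↥(maximalRealSubfield L)) L (IsCMField.complexConj L) 2).Adelic)) : ℝ) : ℝ) : ℂ) ^ z ∂ν) {z : ℂ | 1 < z.re} := by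
  haveI := locallyCompactSpace_adeleRing' L
  haveI := isInvInvariant_of_isHaarMeasure_two (F := ↥(maximalRealSubfield L)) (E := L) (c := IsCMField.complexConj L) ν
  have hmeas : Measurable fun v : ↥(adelicUnipotent (↥(maximalRealSubfield L)) L (IsCMField.complexConj L) 2) => (borelHeight (((quasiSplit (↥(maximalRealSubfield L)) L (IsCMField.complexConj L) 2).toAdelic (weylLongU ((IsCMField.complexConj L : L ≃ₐ[↥(maximalRealSubfield L)] L) : L →+* L) (rfl : ((StdForm.antidiagonal 2).over L) = ((StdForm.antidiagonal 2).over L)))) * (v : (quasiSplit (↥(maximalRealSubfield L)) L (IsCMField.complexConj L) 2).Adelic)) : ℝ) :=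
    (NNReal.continuous_coe.comp (continuous_borelHeight.comp (continuous_const.mul continuous_subtype_val))).measurable
  refine (differentiableOn_integral_ofReal_cpow hmeas (fun v => by exact_mod_cast borelHeight_pos _) fun σ hσ => ?_).const_mul _
  simpa only [mul_one] using integrable_borelHeight_weylLongU_mul_rpow_cm_two L ν h𝓕N h𝓕c hσ 1

omit [IsCMField L] in
/-- **Real point of `c_∞`**: `c_∞(σ) = ((μ_E(D_∞)⁻¹·∫ A^{−σ} dμ_E : ℝ) : ℂ)` — ★ FILE 3's archimedean term. [folklore] -/
theorem archMean_ofReal (μE : Measure (mixedSpace ↥(maximalRealSubfield L))) (σ : ℝ) :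
    ((((μE (ZSpan.fundamentalDomain (latticeBasis ↥(maximalRealSubfield L)))).toReal⁻¹ : ℝ)) : ℂ) * ∫ s : mixedSpace ↥(maximalRealSubfield L), (((∏ w : InfinitePlace L, ((1 : ℝ) + (w δ) ^ 2 * (s.1 ⟨w.comap (algebraMap ↥(maximalRealSubfield L) L), K2E1HeightBigCellLineFormulaU2.isReal_comap_maximalRealSubfield L w⟩) ^ 2)) : ℝ) : ℂ) ^ (-((σ : ℝ) : ℂ)) ∂μE =
      ((((μE (ZSpan.fundamentalDomain (latticeBasis ↥(maximalRealSubfield L)))).toReal⁻¹ * ∫ s : mixedSpace ↥(maximalRealSubfield L), (∏ w : InfinitePlace L, ((1 : ℝ) + (w δ) ^ 2 * (s.1 ⟨w.comap (algebraMap ↥(maximalRealSubfield L) L), K2E1HeightBigCellLineFormulaU2.isReal_comap_maximalRealSubfield L w⟩) ^ 2)) ^ (-σ) ∂μE : ℝ)) : ℂ) := by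
  rw [integral_ofReal_cpow_neg_ofReal (fun s => (archFactor_pos L s).le)]
  push_cast
  ring

omit [IsCMField L] in
/-- **Real point of `a_v`**: `a_v(σ) = νv(𝒪_v)⁻¹ • ∫ ((P_v^{−σ} : ℝ) : ℂ) dνv` — ★ FILE 3's local mean, literally. [folklore] -/
theorem localMean_ofReal (v : HeightOneSpectrum (𝓞 ↥(maximalRealSubfield L)))
    [MeasurableSpace (v.adicCompletion ↥(maximalRealSubfield L))] (μ : Measure (v.adicCompletion ↥(maximalRealSubfield L))) (σ : ℝ) :
    ((((μ (v.adicCompletionIntegers ↥(maximalRealSubfield L))).toReal⁻¹ : ℝ)) : ℂ) * ∫ t : v.adicCompletion ↥(maximalRealSubfield L), ((((letI := Extension.fintype (𝓞 ↥(maximalRealSubfield L)) ↥(maximalRealSubfield L) L (𝓞 L) v; ∏ w : v.Extension (𝓞 L), max 1 (normAbs (w.1.adicCompletion L) (Extension.adicCompletionSemialgHom ↥(maximalRealSubfield L) L w t) * normAbs (w.1.adicCompletion L) ((algebraMap L (FiniteAdeleRing (𝓞 L) L) δ) w.1))) : ℝ≥0) : ℝ) : ℂ) ^ (-((σ : ℝ)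 : ℂ)) ∂μ =
      (μ (v.adicCompletionIntegers ↥(maximalRealSubfield L))).toReal⁻¹ • ∫ t : v.adicCompletion ↥(maximalRealSubfield L), ((((((letI := Extension.fintype (𝓞 ↥(maximalRealSubfield L)) ↥(maximalRealSubfield L) L (𝓞 L) v; ∏ w : v.Extension (𝓞 L), max 1 (normAbs (w.1.adicCompletion L) (Extension.adicCompletionSemialgHom ↥(maximalRealSubfield L) L w t) * normAbs (w.1.adicCompletion L) ((algebraMap L (FiniteAdeleRing (𝓞 L) L) δ) w.1))) : ℝ≥0) : ℝ) ^ (-σ) : ℝ)) : ℂ) ∂μ := by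
  rw [Complex.real_smul]
  congr 1
  refine integral_congr_ae (Eventually.of_forall fun t => ?_)
  show ((((letI := Extension.fintype (𝓞 ↥(maximalRealSubfield L)) ↥(maximalRealSubfield L) L (𝓞 L) v; ∏ w : v.Extension (𝓞 L), max 1 (normAbs (w.1.adicCompletion L) (Extension.adicCompletionSemialgHom ↥(maximalRealSubfield L) L w t) * normAbs (w.1.adicCompletion L) ((algebraMap L (FiniteAdeleRing (𝓞 L) L) δ) w.1))) : ℝ≥0) : ℝ) : ℂ) ^ (-((σ : ℝ) : ℂ)) = ((((((letI := Extension.fintype (𝓞 ↥(maximalRealSubfield L)) ↥(maximalRealSubfield L) L (𝓞 L) v; ∏ w : v.Extension (𝓞 L), max 1 (normAbs (w.1.adicCompletion L) (Extension.adicCompletionSemialgHom ↥(maximalRealSubfield L) L w t) * normAbs (w.1.adicCompletion L) ((algebraMap L (FiniteAdeleRing (𝓞 L) L) δ) w.1))) : ℝ≥0) : ℝ) ^ (-σ) : ℝ)) : ℂ)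
  rw [Complex.ofReal_cpow (NNReal.coe_nonneg _), Complex.ofReal_neg]

/-- **Real point of `c`**: `c(σ) = ((ν(𝓕)⁻¹·∫ H(w₀v)^σ dν : ℝ) : ℂ)` — ★ FILE 3's left-hand side. [folklore] -/
theorem intertwiningScalar_ofReal [MeasurableSpace (quasiSplit (↥(maximalRealSubfield L)) L (IsCMField.complexConj L) 2).Adelic]
    (ν : Measure ↥(adelicUnipotent (↥(maximalRealSubfield L)) L (IsCMField.complexConj L) 2)) (𝓕 : Set ↥(adelicUnipotent (↥(maximalRealSubfield L)) L (IsCMField.complexConj L) 2)) (σ : ℝ) :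
    ((((ν 𝓕).toReal⁻¹ : ℝ)) : ℂ) * ∫ v, (((borelHeight (((quasiSplit (↥(maximalRealSubfield L)) L (IsCMField.complexConj L) 2).toAdelic (weylLongU ((IsCMField.complexConj L : L ≃ₐ[↥(maximalRealSubfield L)] L) : L →+* L) (rfl : ((StdForm.antidiagonal 2).over L) = ((StdForm.antidiagonal 2).over L)))) * (v : (quasiSplit (↥(maximalRealSubfield L)) L (IsCMField.complexConj L) 2).Adelic)) : ℝ) : ℝ) : ℂ) ^ ((σ : ℝ) : ℂ) ∂ν = ((((ν 𝓕).toReal⁻¹ * ∫ v, ((borelHeight (((quasiSplit (↥(maximalRealSubfield L)) L (IsCMField.complexConj L) 2).toAdelic (weylLongU ((IsCMField.complexConj L : L ≃ₐ[↥(maximalRealSubfield L)] L) : L →+* L) (rfl : ((StdForm.antidiagonal 2).over L) = ((StdForm.antidiagonal 2).over L)))) * (v : (quasiSplit (↥(maximalRealSubfield L)) L (IsCMField.complexConj L) 2).Adelic)) : ℝ) : ℝ) ^ σ ∂ν : ℝ)) : ℂ) := by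
  rw [integral_ofReal_cpow_ofReal (fun v => NNReal.coe_nonneg _)]
  push_cast
  ring

include hδ in
/-- **`c_∞(1) ≠ 0`**: at `z = 1` the archimedean mean is the positive real `μ_E(D_∞)⁻¹·∫ A^{−1} dμ_E` (`0 < μ_E(D_∞) < ∞`: Mathlib `ZSpan.measure_fundamentalDomain_ne_zero`, bounded domain).
[cite: MoeglinWaldspurger1995, IV.1.11] -/
theorem archMean_one_ne_zero (μE : Measure (mixedSpace ↥(maximalRealSubfield L))) [μE.IsAddHaarMeasure] :
    ((((μE (ZSpan.fundamentalDomain (latticeBasis ↥(maximalRealSubfield L)))).toReal⁻¹ : ℝ)) : ℂ) * ∫ s : mixedSpace ↥(maximalRealSubfield L), (((∏ w : InfinitePlace L, ((1 : ℝ) + (w δ) ^ 2 * (s.1 ⟨w.comap (algebraMap ↥(maximalRealSubfield L) L), K2E1HeightBigCellLineFormulaU2.isReal_comap_maximalRealSubfield L w⟩) ^ 2)) : ℝ) : ℂ) ^ (-(1 : ℂ)) ∂μE ≠ 0 := by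
  have h := archMean_ofReal L (δ := δ) μE 1
  rw [Complex.ofReal_one] at h
  rw [h, Complex.ofReal_ne_zero]
  refine (mul_pos (inv_pos.2 (ENNReal.toReal_pos (ZSpan.measure_fundamentalDomain_ne_zero _) ?_)) ?_).ne'
  · exact ((ZSpan.fundamentalDomain_isBounded _).measure_lt_top).ne
  · exact integral_rpow_pos (archFactor_pos L) (integrable_archFactor_rpow_neg_of_half_lt L hδ μE (x := 1) (by norm_num))

include hδ in
/-- **`a_v(1) ≠ 0`**: at `z = 1` the local mean is the positive real `νv(𝒪_v)⁻¹·∫ P_v^{−1} dνv` (`0 < νv(𝒪_v)`: ★ `LocalFieldHaar.measureReal_primePowBall_pos`, `𝒪_v = 𝔭_v^0`).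
[cite: Langlands1976, Appendix] -/
theorem localMean_one_ne_zero (v : HeightOneSpectrum (𝓞 ↥(maximalRealSubfield L)))
    [MeasurableSpace (v.adicCompletion ↥(maximalRealSubfield L))] [BorelSpace (v.adicCompletion ↥(maximalRealSubfield L))]
    (μ : Measure (v.adicCompletion ↥(maximalRealSubfield L))) [μ.IsAddHaarMeasure] :
    ((((μ (v.adicCompletionIntegers ↥(maximalRealSubfield L))).toReal⁻¹ : ℝ)) : ℂ) * ∫ t : v.adicCompletion ↥(maximalRealSubfield L), ((((letI := Extension.fintype (𝓞 ↥(maximalRealSubfield L)) ↥(maximalRealSubfield L) L (𝓞 L) v; ∏ w : v.Extension (𝓞 L), max 1 (normAbs (w.1.adicCompletion L) (Extension.adicCompletionSemialgHom ↥(maximalRealSubfield L) L w t) * normAbs (w.1.adicCompletion L) ((algebraMap L (FiniteAdeleRing (𝓞 L) L) δ) w.1))) : ℝ≥0) : ℝ) : ℂ) ^ (-(1 : ℂ)) ∂μ ≠ 0 := by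
  letI := Extension.fintype (𝓞 ↥(maximalRealSubfield L)) ↥(maximalRealSubfield L) L (𝓞 L) v
  have h1 : (∫ t : v.adicCompletion ↥(maximalRealSubfield L), ((((letI := Extension.fintype (𝓞 ↥(maximalRealSubfield L)) ↥(maximalRealSubfield L) L (𝓞 L) v; ∏ w : v.Extension (𝓞 L), max 1 (normAbs (w.1.adicCompletion L) (Extension.adicCompletionSemialgHom ↥(maximalRealSubfield L) L w t) * normAbs (w.1.adicCompletion L) ((algebraMap L (FiniteAdeleRing (𝓞 L) L) δ) w.1))) : ℝ≥0) : ℝ) : ℂ) ^ (-(1 : ℂ)) ∂μ) =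
      (((∫ t : v.adicCompletion ↥(maximalRealSubfield L), (((letI := Extension.fintype (𝓞 ↥(maximalRealSubfield L)) ↥(maximalRealSubfield L) L (𝓞 L) v; ∏ w : v.Extension (𝓞 L), max 1 (normAbs (w.1.adicCompletion L) (Extension.adicCompletionSemialgHom ↥(maximalRealSubfield L) L w t) * normAbs (w.1.adicCompletion L) ((algebraMap L (FiniteAdeleRing (𝓞 L) L) δ) w.1))) : ℝ≥0) : ℝ) ^ (-(1 : ℝ)) ∂μ : ℝ)) : ℂ) := by
    rw [← Complex.ofReal_one]
    exact integral_ofReal_cpow_neg_ofReal (fun t => NNReal.coe_nonneg _) 1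
  rw [h1, ← Complex.ofReal_mul, Complex.ofReal_ne_zero]
  have hball : primePowBall (v.adicCompletion ↥(maximalRealSubfield L)) 0 = (v.adicCompletionIntegers ↥(maximalRealSubfield L) : Set (v.adicCompletion ↥(maximalRealSubfield L))) :=
    Set.ext fun t => mem_primePowBall_zero_iff t
  have hpos : 0 < (μ (v.adicCompletionIntegers ↥(maximalRealSubfield L))).toReal := by
    have h := LocalFieldHaar.measureReal_primePowBall_pos μ 0
    rwa [Measure.real, hball] at h
  exact (mul_pos (inv_pos.2 hpos) (integral_rpow_pos (fun t => lt_of_lt_of_le zero_lt_one (by exact_mod_cast one_le_localHeight L v t))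
    (integrable_localFactor_rpow_neg_of_half_lt L hδ v μ (x := 1) (by norm_num)))).ne'

end Summit.HodgeConjecture.HodgeConjecture.Cruxes.H413.K2E1IntertwiningLocalFactorIntegrableU2

end
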